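import Summits.QuantumFields.YangMills.Theorems.WeakCouplingRatesHarmonicInteriorKernel
import Summits.QuantumFields.YangMills.Theorems.WeakCouplingRatesBoxDecay
import Literature.MathematicalPhysics.QuantumFieldTheory.LatticeConvolution
import HarnessLib

/-!
# Interior regularity of lattice-harmonic functions, file 3/3: the interior gradient estimate on `ℤ⁴`

Helper file (`--supports stmt-QuantumFields-19609`); theorems only.

WHY (crux `BulkDominatesColdBoxW`, stmt-QuantumFields-19609, open stubs L1a/L1b; seat `ym-spine-20043-p1` g2 re-targeted by director-ym
LINE №76/№78 to the BACKGROUND piece of L1b `stub_goodBoundaryMeanSmooth`).  L1b compares the box-kernel means of the plaquette cost at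
the centre `p` and at `p + T e₀` (depth `H = ⌈β^θ⌉`, `T = ⌈β^A⌉ ≪ H`) uniformly over crude-good boundary data; the leading (classical)
contribution is `c_{p'}(Ū) − c_p(Ū)` for the minimal-action background `Ū` extending the datum, of size `2 sup|F̄| · T · sup|∇F̄|`, so the
estimate rests on the INTERIOR GRADIENT BOUND `|∇F̄| ≲ sup|F̄| / H`.  Each component of the linearised curvature is LATTICE-HARMONIC in
the interior (`Δ_Hodge = −Δ` componentwise on `ℤ⁴`); the scalar input is the classical interior difference estimate for harmonic
functions (Lawler 1991 Thm. 1.7.1 (a); Lawler–Limic 2010 Thm. 6.3.8), proved in this three-file series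
(`…HarmonicInteriorDefs` → `…HarmonicInteriorKernel` → `…HarmonicInteriorGradient`) from the tree's Green-function bounds.

This file (`d = 4`, sup norm `‖·‖` of the tree):
* `card_filter_kink_le`, `sum_abs_dtwo_le` — at most `4(2R+1)^{d−1}` kink sites in `sbox R`, so `Σ |dtwo| ≤ (2/r)·4(2R+1)^{d−1}`;
* `abs_term_le` — one term of the `x`-difference of `K₁` is a mixed second difference of `gHalf` times `∇χ = O(1/r)`
  (tree `exists_latticeGreen_hess_bound`: `O(r⁻⁴)`) plus `∇gHalf = O(r⁻³)` (tree `exists_latticeGreen_grad_bound`) times `Δχ`;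
* **`harmonic_gradient_le`** — there is `C > 0` with `|u(x + eⱼ) − u(x)| ≤ C · M / r` for all `r ≥ 4`, all `u` with `Δu = 0`
  wherever all `|z_k| < 2r` and `|u| ≤ M` wherever all `|z_k| ≤ 2r+1`, all `x` with `4|x_k| ≤ r`, all `j`
  (Lawler–Limic Thm. 6.3.8 (a) in sup-box form; one constant from the tree's `K_g`, `K_h`);
  **`harmonic_gradient_le_centre`** — the same about any centre `c`;
* §5 `latticeLaplacianZd_component_eq_zero` — a closed (`d₂ M = 0`) and co-closed (`div₂ M = 0`) lattice 2-form is componentwise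
  harmonic (tree Hodge identity `LatticeChain.div₃_d₂_add_d₁_div₂`); **`closed_coclosed_gradient_le`** — the interior gradient
  estimate for such 2-forms on `ℤ⁴` (the linearised background curvature of L1b).

No sorry, standard axioms.  NOT a claim about the mass gap.

References: G. F. Lawler, V. Limic, *Random Walk: A Modern Introduction* (2010) Thm. 6.3.8; T. Bałaban, CMP 89 (1983) (the
gauge-covariant analogue needed downstream).
-/

set_option autoImplicit false

noncomputable section

open Finset Filter Topology
open Literature.Probability.LatticeModels
open Literature.MathematicalPhysics.QuantumFieldTheory.LatticeForm (e)

namespace Summit.QuantumFields.YangMills.Theorems.WeakCouplingRates.HarmonicInterior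

variable {d : ℕ}

/-! ## §4 Counting kink sites, and the interior gradient estimate on `ℤ⁴` -/

/-- At most `4 (2R+1)^{d-1}` sites of the sup-box have their `i`-th coordinate on one of the kink values `±a, ±b`. -/
theorem card_filter_kink_le (R : ℕ) (i : Fin d) (a b : ℤ) :
    #{z ∈ sbox (d := d) R | |z i| = a ∨ |z i| = b} ≤ 4 * (2 * R + 1) ^ (d - 1) := by
  classical
  set I : Finset ℤ := Finset.Icc (-(R : ℤ)) R with hI
  set A : Finset ℤ := I.filter (fun t => |t| = a ∨ |t| = b) with hA
  have hAI : A ⊆ I := Finset.filter_subset _ _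
  have hset : {z ∈ sbox (d := d) R | |z i| = a ∨ |z i| = b} =
      Fintype.piFinset (Function.update (fun _ : Fin d => I) i A) := by
    rw [Fintype.piFinset_update_eq_filter_piFinset_mem _ _ hAI]
    refine Finset.filter_congr fun z hz => ?_
    have hzi : z i ∈ I := (Fintype.mem_piFinset.1 hz) i
    simp only [hA, Finset.mem_filter, hzi, true_and]
  have hcardA : #A ≤ 4 := by
    have hsub : A ⊆ ({a, -a, b, -b} : Finset ℤ) := by
      intro t ht
      rw [hA, Finset.mem_filter] at ht
      simp only [Finset.mem_insert, Finset.mem_singleton]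
      rcases ht.2 with h | h
      · rcases (abs_eq (h ▸ abs_nonneg t)).1 h with h' | h' <;> simp [h']
      · rcases (abs_eq (h ▸ abs_nonneg t)).1 h with h' | h' <;> simp [h']
    refine (Finset.card_le_card hsub).trans ?_
    refine (Finset.card_insert_le _ _).trans ?_
    refine (Nat.add_le_add_right (Finset.card_insert_le _ _) 1).trans ?_
    refine (Nat.add_le_add_right (Nat.add_le_add_right (Finset.card_insert_le _ _) 1) 1).trans ?_
    simp
  rw [hset, Fintype.card_piFinset]
  have hfun : (fun k => #(Function.update (fun _ : Fin d => I) i A k)) = Function.update (fun _ : Fin d => #I) i #A := by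
    funext k
    by_cases hk : k = i
    · subst hk; simp
    · simp [Function.update_of_ne hk]
  rw [hfun, Finset.prod_update_of_mem (Finset.mem_univ i), Finset.prod_const]
  have hcard : #(Finset.univ \ {i} : Finset (Fin d)) = d - 1 := by
    rw [Finset.card_sdiff_of_subset (Finset.subset_univ _), Finset.card_univ, Fintype.card_fin, Finset.card_singleton]
  rw [hcard, hI, Int.card_Icc, show ((R : ℤ) + 1 - -(R : ℤ)).toNat = 2 * R + 1 by omega]
  exact Nat.mul_le_mul_right _ hcardA

/-- The sum of `|dtwo r i|` over the sup-box of radius `R` is at most `(2/r) · 4 (2R+1)^{d-1}`. -/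
theorem sum_abs_dtwo_le {r : ℕ} (hr : 0 < r) (R : ℕ) (i : Fin d) :
    ∑ z ∈ sbox (d := d) R, |dtwo r i z| ≤ 2 / r * (4 * (2 * R + 1) ^ (d - 1) : ℕ) := by
  classical
  rw [← Finset.sum_filter_add_sum_filter_not (sbox R) (fun z : Site d => |z i| = (r : ℤ) ∨ |z i| = 2 * (r : ℤ))]
  have h0 : ∑ z ∈ (sbox (d := d) R).filter (fun z => ¬(|z i| = (r : ℤ) ∨ |z i| = 2 * (r : ℤ))), |dtwo r i z| = 0 := by
    refine Finset.sum_eq_zero fun z hz => ?_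
    rw [Finset.mem_filter, not_or] at hz
    rw [dtwo_eq_zero hr hz.2.1 hz.2.2, abs_zero]
  rw [h0, add_zero]
  calc ∑ z ∈ (sbox (d := d) R).filter (fun z => |z i| = (r : ℤ) ∨ |z i| = 2 * (r : ℤ)), |dtwo r i z|
      ≤ ∑ _z ∈ (sbox (d := d) R).filter (fun z => |z i| = (r : ℤ) ∨ |z i| = 2 * (r : ℤ)), (2 / r : ℝ) :=
        Finset.sum_le_sum fun z _ => abs_dtwo_le hr i z
    _ = #((sbox (d := d) R).filter (fun z => |z i| = (r : ℤ) ∨ |z i| = 2 * (r : ℤ))) * (2 / r : ℝ) := by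
        rw [Finset.sum_const, nsmul_eq_mul]
    _ ≤ (4 * (2 * R + 1) ^ (d - 1) : ℕ) * (2 / r : ℝ) := by
        gcongr
        exact_mod_cast card_filter_kink_le R i r (2 * r)
    _ = 2 / r * (4 * (2 * R + 1) ^ (d - 1) : ℕ) := mul_comm _ _

section Dim4

/-- A site of `ℤ⁴` one of whose coordinates is at least `ρ` in absolute value has sup norm at least `ρ`. -/
theorem le_norm_of_le_abs_coord {y : Site 4} {i : Fin 4} {ρ : ℝ} (h : ρ ≤ |((y i : ℤ) : ℝ)|) : ρ ≤ ‖y‖ :=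
  h.trans (abs_coord_le_norm y i)

/-- Coordinate control used in the kernel bounds: if `4|x_i| ≤ r`, `r ≤ |z_i|`, `4 ≤ r` and `|c| ≤ 1`, then
`r/2 ≤ |x_i - z_i + c|`. -/
theorem half_le_abs_coord {r : ℕ} (hr : 4 ≤ r) {xi zi c : ℤ} (hx : 4 * |xi| ≤ (r : ℤ)) (hz : (r : ℤ) ≤ |zi|)
    (hc : |c| ≤ 1) : (r : ℝ) / 2 ≤ |((xi - zi + c : ℤ) : ℝ)| := by
  have hx' := abs_le.1 (show |xi| ≤ (r : ℤ) / 4 by omega)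
  have hc' := abs_le.1 hc
  have key : (r : ℤ) ≤ 2 * |xi - zi + c| := by
    rcases le_abs.1 hz with h | h
    · have : (r : ℤ) ≤ 2 * (-(xi - zi + c)) := by omega
      exact this.trans (mul_le_mul_of_nonneg_left (neg_le_abs _) (by norm_num))
    · have : (r : ℤ) ≤ 2 * (xi - zi + c) := by omega
      exact this.trans (mul_le_mul_of_nonneg_left (le_abs_self _) (by norm_num))
  have : (r : ℝ) ≤ 2 * |((xi - zi + c : ℤ) : ℝ)| := by exact_mod_cast key
  linarith

/-- **Pointwise bound of one term of the `x`-difference of the kernel.**  With `w = x − z`: the term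
`(g(w−eᵢ+eⱼ) − g(w−eᵢ))·dplus − (g(w+eᵢ+eⱼ) − g(w+eᵢ))·dminus` is at most `4K_g/r³ · |dtwo| + 16K_h/r⁵` when
`4|x_k| ≤ r` for all `k` and `r ≥ 4` (Lawler bounds `K_g`, `K_h` of the tree). [folklore] -/
theorem abs_term_le {Kg Kh : ℝ} (hKg : 0 ≤ Kg) (hKh : 0 ≤ Kh)
    (hg : ∀ y : Site 4, y ≠ 0 → ∀ i : Fin 4, |latticeGreen (y + e i) - latticeGreen y| ≤ Kg / ‖y‖ ^ 3)
    (hh : ∀ y : Site 4, y ≠ 0 → ∀ i j : Fin 4, y + e j ≠ 0 →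
      |latticeGreen (y + e j + e i) - latticeGreen (y + e j) - latticeGreen (y + e i) + latticeGreen y| ≤ Kh / ‖y‖ ^ 4)
    {r : ℕ} (hr : 4 ≤ r) (x z : Site 4) (hx : ∀ k, 4 * |x k| ≤ (r : ℤ)) (i j : Fin 4) :
    |(gHalf (x - z - e i + e j) - gHalf (x - z - e i)) * dplus r i z -
        (gHalf (x - z + e i + e j) - gHalf (x - z + e i)) * dminus r i z| ≤
      4 * Kg / r ^ 3 * |dtwo r i z| + 16 * Kh / r ^ 5 := by
  have hr0 : 0 < r := by omega
  have hrpos : (0 : ℝ) < r := by exact_mod_cast hr0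
  have hRHS0 : 0 ≤ 4 * Kg / r ^ 3 * |dtwo r i z| + 16 * Kh / r ^ 5 := by positivity
  by_cases hzi : |z i| + 1 ≤ r
  · -- deep: all differences of the cut-off vanish
    have h1 : dminus r i z = 0 := dminus_eq_zero hr0 hzi
    have h2 : dplus r i z = 0 := by
      have h := dtwo_eq_zero_of_deep hr0 hzi
      rw [dtwo_eq, h1, sub_zero] at h
      exact h
    rw [h1, h2, mul_zero, mul_zero, sub_zero, abs_zero]
    exact hRHS0
  · have hzi' : (r : ℤ) ≤ |z i| := by omega
    set w : Site 4 := x - z with hw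
    have hwi : ∀ c : ℤ, |c| ≤ 1 → (r : ℝ) / 2 ≤ |((x i - z i + c : ℤ) : ℝ)| := fun c hc =>
      half_le_abs_coord hr (hx i) hzi' hc
    -- sup norms of `w`, `w - eᵢ`, `w + eᵢ`
    have hn0 : (r : ℝ) / 2 ≤ ‖w‖ := le_norm_of_le_abs_coord (i := i) (by
      have := hwi 0 (by simp); simpa [hw] using this)
    have hn1 : (r : ℝ) / 2 ≤ ‖w - e i‖ := le_norm_of_le_abs_coord (i := i) (by
      have := hwi (-1) (by simp)
      rw [sub_e_apply_same, hw, Pi.sub_apply]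
      push_cast at this ⊢
      rw [show ((x i : ℤ) : ℝ) - z i - 1 = x i - z i + -1 by ring]
      exact this)
    have hn2 : (r : ℝ) / 2 ≤ ‖w + e i‖ := le_norm_of_le_abs_coord (i := i) (by
      have := hwi 1 (by simp)
      rw [add_e_apply_same, hw, Pi.sub_apply]
      push_cast at this ⊢
      exact this)
    have hρ : (0 : ℝ) < r / 2 := by positivity
    have hw0 : w ≠ 0 := ne_zero_of_norm_pos (hρ.trans_le hn0)
    have hw1 : w - e i ≠ 0 := ne_zero_of_norm_pos (hρ.trans_le hn1)
    have hw2 : w + e i ≠ 0 := ne_zero_of_norm_pos (hρ.trans_le hn2)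
    -- the three Green-function bounds
    have hA : |gHalf (w - e i + e j) - gHalf (w - e i)| ≤ 4 * Kg / r ^ 3 := by
      have h := hg (w - e i) hw1 j
      have hden : Kg / ‖w - e i‖ ^ 3 ≤ Kg / ((r : ℝ) / 2) ^ 3 :=
        div_le_div_of_nonneg_left hKg (pow_pos hρ 3) (pow_le_pow_left₀ hρ.le hn1 3)
      have e8 : Kg / ((r : ℝ) / 2) ^ 3 = 8 * Kg / r ^ 3 := by field_simp; ring
      unfold gHalf
      rw [← sub_div, abs_div, abs_two, div_le_iff₀ (by norm_num : (0:ℝ) < 2)]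
      calc _ ≤ Kg / ‖w - e i‖ ^ 3 := h
        _ ≤ 8 * Kg / r ^ 3 := hden.trans e8.le
        _ = 4 * Kg / r ^ 3 * 2 := by ring
    have hH1 : |gHalf (w + e i + e j) - gHalf (w + e i) - gHalf (w + e j) + gHalf w| ≤ 8 * Kh / r ^ 4 := by
      have h := hh w hw0 j i hw2
      have hden : Kh / ‖w‖ ^ 4 ≤ Kh / ((r : ℝ) / 2) ^ 4 :=
        div_le_div_of_nonneg_left hKh (pow_pos hρ 4) (pow_le_pow_left₀ hρ.le hn0 4)
      have e8 : Kh / ((r : ℝ) / 2) ^ 4 = 16 * Kh / r ^ 4 := by field_simp; ring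
      unfold gHalf
      rw [show latticeGreen (w + e i + e j) / 2 - latticeGreen (w + e i) / 2 - latticeGreen (w + e j) / 2 + latticeGreen w / 2 =
        (latticeGreen (w + e i + e j) - latticeGreen (w + e i) - latticeGreen (w + e j) + latticeGreen w) / 2 by ring,
        abs_div, abs_two, div_le_iff₀ (by norm_num : (0:ℝ) < 2)]
      calc _ ≤ Kh / ‖w‖ ^ 4 := h
        _ ≤ 16 * Kh / r ^ 4 := hden.trans e8.le
        _ = 8 * Kh / r ^ 4 * 2 := by ring
    have hH2 : |gHalf (w + e j) - gHalf w - gHalf (w - e i + e j) + gHalf (w - e i)| ≤ 8 * Kh / r ^ 4 := by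
      have h := hh (w - e i) hw1 j i (by rw [sub_add_cancel]; exact hw0)
      rw [sub_add_cancel] at h
      have hden : Kh / ‖w - e i‖ ^ 4 ≤ Kh / ((r : ℝ) / 2) ^ 4 :=
        div_le_div_of_nonneg_left hKh (pow_pos hρ 4) (pow_le_pow_left₀ hρ.le hn1 4)
      have e8 : Kh / ((r : ℝ) / 2) ^ 4 = 16 * Kh / r ^ 4 := by field_simp; ring
      unfold gHalf
      rw [show latticeGreen (w + e j) / 2 - latticeGreen w / 2 - latticeGreen (w - e i + e j) / 2 + latticeGreen (w - e i) / 2 =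
        (latticeGreen (w + e j) - latticeGreen w - latticeGreen (w - e i + e j) + latticeGreen (w - e i)) / 2 by ring,
        abs_div, abs_two, div_le_iff₀ (by norm_num : (0:ℝ) < 2)]
      calc _ ≤ Kh / ‖w - e i‖ ^ 4 := h
        _ ≤ 16 * Kh / r ^ 4 := hden.trans e8.le
        _ = 8 * Kh / r ^ 4 * 2 := by ring
    -- algebra: `dplus = dtwo + dminus`
    have hsplit : (gHalf (w - e i + e j) - gHalf (w - e i)) * dplus r i z -
          (gHalf (w + e i + e j) - gHalf (w + e i)) * dminus r i z =
        (gHalf (w - e i + e j) - gHalf (w - e i)) * dtwo r i z -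
          ((gHalf (w + e i + e j) - gHalf (w + e i) - gHalf (w + e j) + gHalf w) +
            (gHalf (w + e j) - gHalf w - gHalf (w - e i + e j) + gHalf (w - e i))) * dminus r i z := by
      rw [dtwo_eq]; ring
    rw [hsplit]
    have hdm := abs_dminus_le hr0 i z
    calc |(gHalf (w - e i + e j) - gHalf (w - e i)) * dtwo r i z -
          ((gHalf (w + e i + e j) - gHalf (w + e i) - gHalf (w + e j) + gHalf w) +
            (gHalf (w + e j) - gHalf w - gHalf (w - e i + e j) + gHalf (w - e i))) * dminus r i z|
        ≤ |gHalf (w - e i + e j) - gHalf (w - e i)| * |dtwo r i z| +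
          (|gHalf (w + e i + e j) - gHalf (w + e i) - gHalf (w + e j) + gHalf w| +
            |gHalf (w + e j) - gHalf w - gHalf (w - e i + e j) + gHalf (w - e i)|) * |dminus r i z| := by
          refine (abs_sub _ _).trans (add_le_add ?_ ?_)
          · rw [abs_mul]
          · rw [abs_mul]; exact mul_le_mul_of_nonneg_right (abs_add_le _ _) (abs_nonneg _)
      _ ≤ 4 * Kg / r ^ 3 * |dtwo r i z| + (8 * Kh / r ^ 4 + 8 * Kh / r ^ 4) * (1 / r) :=
          add_le_add (mul_le_mul_of_nonneg_right hA (abs_nonneg _))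
            (mul_le_mul (add_le_add hH1 hH2) hdm (abs_nonneg _) (by positivity))
      _ = 4 * Kg / r ^ 3 * |dtwo r i z| + 16 * Kh / r ^ 5 := by field_simp; ring

/-- **The interior difference (gradient) estimate for lattice-harmonic functions on `ℤ⁴`** (Lawler–Limic Thm. 6.3.8 (a) in
sup-box form): there is `C > 0` such that for every `r ≥ 4`, every `u` with `Δu = 0` at all sites with `|z_k| < 2r` and
`|u| ≤ M` on the sup-box of radius `2r + 1`, and every `x` with `4|x_k| ≤ r` for all `k`:
`|u(x + eⱼ) − u(x)| ≤ C · M / r`. [cite: LawlerLimic2010, Thm. 6.3.8] -/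
theorem harmonic_gradient_le : ∃ C : ℝ, 0 < C ∧ ∀ (r : ℕ), 4 ≤ r → ∀ (u : Site 4 → ℝ) (M : ℝ),
    (∀ z : Site 4, (∀ k, |z k| < 2 * (r : ℤ)) → latticeLaplacianZd u z = 0) →
    (∀ z : Site 4, (∀ k, |z k| ≤ 2 * (r : ℤ) + 1) → |u z| ≤ M) →
    ∀ x : Site 4, (∀ k, 4 * |x k| ≤ (r : ℤ)) → ∀ j : Fin 4, |u (x + e j) - u x| ≤ C * M / r := by
  obtain ⟨Kg, hKg, hg⟩ := exists_latticeGreen_grad_bound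
  obtain ⟨Kh, hKh, hh⟩ := exists_latticeGreen_hess_bound
  refine ⟨16000 * Kg + 40000 * Kh + 1, by positivity, fun r hr u M hharm hM x hx j => ?_⟩
  have hr0 : 0 < r := by omega
  have hrpos : (0 : ℝ) < r := by exact_mod_cast hr0
  have hM0 : 0 ≤ M := (abs_nonneg _).trans (hM 0 fun k => by simp only [Pi.zero_apply, abs_zero]; positivity)
  have hx' : ∀ k, |x k| + 1 ≤ (r : ℤ) := fun k => by have := hx k; have := abs_nonneg (x k); omega
  rw [harmonic_sub_eq_sum_kernel (by norm_num) hr0 u hharm x hx' j]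
  -- pointwise bound of the kernel difference
  have hK : ∀ z ∈ sbox (d := 4) (2 * r + 1), |u z * (kernel₁ r (x + e j) z - kernel₁ r x z)| ≤
      M * ∑ i : Fin 4, (4 * Kg / r ^ 3 * |dtwo r i z| + 16 * Kh / r ^ 5) := by
    intro z hz
    rw [abs_mul]
    refine mul_le_mul (hM z fun k => by have := mem_sbox.1 hz k; push_cast at this; exact this) ?_ (abs_nonneg _) hM0
    unfold kernel₁
    rw [← Finset.sum_sub_distrib]
    refine (Finset.abs_sum_le_sum_abs _ _).trans (Finset.sum_le_sum fun i _ => ?_)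
    have e1 : x + e j - z - e i = x - z - e i + e j := by abel
    have e2 : x + e j - z + e i = x - z + e i + e j := by abel
    rw [e1, e2, show gHalf (x - z - e i + e j) * dplus r i z - gHalf (x - z + e i + e j) * dminus r i z -
        (gHalf (x - z - e i) * dplus r i z - gHalf (x - z + e i) * dminus r i z) =
      (gHalf (x - z - e i + e j) - gHalf (x - z - e i)) * dplus r i z -
        (gHalf (x - z + e i + e j) - gHalf (x - z + e i)) * dminus r i z by ring]
    exact abs_term_le hKg hKh (fun y hy i => (hg y hy i).1) hh hr x z hx i j
  refine (Finset.abs_sum_le_sum_abs _ _).trans ((Finset.sum_le_sum hK).trans ?_)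
  rw [← Finset.mul_sum]
  -- the two counts
  have h5 : ((2 * (2 * r + 1) + 1 : ℕ) : ℝ) ≤ 5 * r := by
    have : 2 * (2 * r + 1) + 1 ≤ 5 * r := by omega
    exact_mod_cast this
  have h5' : ((2 : ℝ) * (2 * r + 1) + 1) ≤ 5 * r := by exact_mod_cast h5
  have hpow3 : ((4 * (2 * (2 * r + 1) + 1) ^ 3 : ℕ) : ℝ) ≤ 4 * (5 * r) ^ 3 := by
    push_cast; gcongr
  have hpow4 : (((2 * (2 * r + 1) + 1) ^ 4 : ℕ) : ℝ) ≤ (5 * r) ^ 4 := by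
    push_cast; gcongr
  have hper : ∀ i : Fin 4, ∑ z ∈ sbox (d := 4) (2 * r + 1), (4 * Kg / r ^ 3 * |dtwo r i z| + 16 * Kh / r ^ 5) ≤
      4 * Kg / r ^ 3 * (2 / r * (4 * (5 * r) ^ 3)) + (5 * r) ^ 4 * (16 * Kh / r ^ 5) := by
    intro i
    rw [Finset.sum_add_distrib, Finset.sum_const, card_sbox, nsmul_eq_mul, ← Finset.mul_sum]
    refine add_le_add ?_ ?_
    · refine mul_le_mul_of_nonneg_left ((sum_abs_dtwo_le hr0 (2 * r + 1) i).trans ?_) (by positivity)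
      exact mul_le_mul_of_nonneg_left (by simpa using hpow3) (by positivity)
    · exact mul_le_mul_of_nonneg_right (by simpa using hpow4) (by positivity)
  have hS : ∑ z ∈ sbox (d := 4) (2 * r + 1), ∑ i : Fin 4, (4 * Kg / r ^ 3 * |dtwo r i z| + 16 * Kh / r ^ 5) ≤
      (16000 * Kg + 40000 * Kh) / r := by
    rw [Finset.sum_comm]
    refine (Finset.sum_le_sum fun i _ => hper i).trans ?_
    rw [Finset.sum_const, Finset.card_univ, Fintype.card_fin, nsmul_eq_mul]
    have e : ((4 : ℕ) : ℝ) * (4 * Kg / r ^ 3 * (2 / r * (4 * (5 * r) ^ 3)) + (5 * r) ^ 4 * (16 * Kh / r ^ 5)) =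
        (16000 * Kg + 40000 * Kh) / r := by
      push_cast; field_simp; ring
    rw [e]
  calc M * ∑ z ∈ sbox (d := 4) (2 * r + 1), ∑ i : Fin 4, (4 * Kg / r ^ 3 * |dtwo r i z| + 16 * Kh / r ^ 5)
      ≤ M * ((16000 * Kg + 40000 * Kh) / r) := mul_le_mul_of_nonneg_left hS hM0
    _ = (16000 * Kg + 40000 * Kh) * M / r := by ring
    _ ≤ (16000 * Kg + 40000 * Kh + 1) * M / r :=
        div_le_div_of_nonneg_right (mul_le_mul_of_nonneg_right (by linarith) hM0) hrpos.le

/-- **The interior gradient estimate about an arbitrary centre `c`** (translate of `harmonic_gradient_le`): `Δu = 0` where all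
`|z_k − c_k| < 2r`, `|u| ≤ M` where all `|z_k − c_k| ≤ 2r + 1`, `4|x_k − c_k| ≤ r` ⇒ `|u(x + eⱼ) − u(x)| ≤ C · M / r`. [folklore] -/
theorem harmonic_gradient_le_centre : ∃ C : ℝ, 0 < C ∧ ∀ (r : ℕ), 4 ≤ r → ∀ (u : Site 4 → ℝ) (c : Site 4) (M : ℝ),
    (∀ z : Site 4, (∀ k, |z k - c k| < 2 * (r : ℤ)) → latticeLaplacianZd u z = 0) →
    (∀ z : Site 4, (∀ k, |z k - c k| ≤ 2 * (r : ℤ) + 1) → |u z| ≤ M) →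
    ∀ x : Site 4, (∀ k, 4 * |x k - c k| ≤ (r : ℤ)) → ∀ j : Fin 4, |u (x + e j) - u x| ≤ C * M / r := by
  obtain ⟨C, hC, h⟩ := harmonic_gradient_le
  refine ⟨C, hC, fun r hr u c M hharm hM x hx j => ?_⟩
  have h' := h r hr (fun z => u (z + c)) M (fun z hz => ?_)
    (fun z hz => hM (z + c) fun k => by simpa using hz k) (x - c) (fun k => by simpa using hx k) j
  · have e1 : x - c + e j + c = x + e j := by abel
    have e2 : x - c + c = x := sub_add_cancel x c
    simp only [e1, e2] at h'
    exact h'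
  · rw [latticeLaplacianZd_comp_add]
    exact hharm (z + c) fun k => by simpa using hz k

end Dim4

/-! ## §5 Closed and co-closed lattice 2-forms are componentwise harmonic; their interior gradient estimate -/

section Forms

open Literature.MathematicalPhysics.QuantumFieldTheory.LatticeForm (d₁ d₂)
open Literature.MathematicalPhysics.QuantumFieldTheory.LatticeChain (div₂ div₃ negLap₂ negLap₀)

/-- The tree's `negLap₀` is minus the graph Laplacian `latticeLaplacianZd`. [folklore] -/
theorem negLap₀_eq_neg_latticeLaplacianZd (F : Site d → ℝ) (y : Site d) :
    negLap₀ F y = -latticeLaplacianZd F y := by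
  have h : ∀ i : Fin d, (F y - F (y + e i)) + (F y - F (y - e i)) = 2 * F y - (F (y + e i) + F (y - e i)) :=
    fun i => by ring
  simp only [negLap₀, latticeLaplacianZd, ← e_def, h, Finset.sum_sub_distrib, Finset.sum_const, Finset.card_univ,
    Fintype.card_fin, nsmul_eq_mul]
  ring

/-- **A closed (`d₂ M = 0`) and co-closed (`div₂ M = 0`) lattice 2-form is componentwise lattice-harmonic**: if both hold at
every site of the sup-ball of radius `1` about `y`, then `Δ (M · k l) (y) = 0` for all `k, l` (the Hodge identity
`div₃ d₂ + d₁ div₂ = −Δ` of the tree, `LatticeChain.div₃_d₂_add_d₁_div₂`, read at `y`). [folklore] -/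
theorem latticeLaplacianZd_component_eq_zero (M : Site d → Fin d → Fin d → ℝ) (y : Site d)
    (hd : ∀ w : Site d, (∀ m, |w m - y m| ≤ 1) → ∀ a b c, d₂ M w a b c = 0)
    (hδ : ∀ w : Site d, (∀ m, |w m - y m| ≤ 1) → ∀ a, div₂ M w a = 0) (k l : Fin d) :
    latticeLaplacianZd (fun z => M z k l) y = 0 := by
  have hH := congrFun (congrFun (congrFun (Literature.MathematicalPhysics.QuantumFieldTheory.LatticeChain.div₃_d₂_add_d₁_div₂ M) y) k) l
  rw [Literature.MathematicalPhysics.QuantumFieldTheory.LatticeChain.negLap₂_apply, negLap₀_eq_neg_latticeLaplacianZd] at hH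
  simp only [Pi.add_apply] at hH
  -- every term on the left vanishes
  have hy : ∀ m, |y m - y m| ≤ 1 := fun m => by simp
  have hnb : ∀ (j : Fin d) (s : ℤ), |s| ≤ 1 → ∀ m, |(y + (Pi.single j s : Site d)) m - y m| ≤ 1 := by
    intro j s hs m
    by_cases hm : m = j
    · subst hm; simpa using hs
    · simp [hm]
  have h1 : div₃ (d₂ M) y k l = 0 := by
    simp only [div₃]
    refine Finset.sum_eq_zero fun j _ => ?_
    have hm : y - e j = y + Pi.single j (-1 : ℤ) := by simp [e_def, sub_eq_add_neg, ← Pi.single_neg]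
    rw [hd y hy, hm, hd _ (hnb j (-1) (by simp)), sub_zero]
  have h2 : d₁ (div₂ M) y k l = 0 := by
    simp only [d₁]
    rw [hδ y hy, hδ y hy, show y + e k = y + Pi.single k (1 : ℤ) from rfl, show y + e l = y + Pi.single l (1 : ℤ) from rfl,
      hδ _ (hnb k 1 (by simp)), hδ _ (hnb l 1 (by simp))]
    ring
  rw [h1, h2, zero_add] at hH
  linarith

/-- **Interior gradient estimate for closed and co-closed lattice 2-forms on `ℤ⁴`** (the linearised curvature of the
background): if `d₂ M = 0` and `div₂ M = 0` at every site with all `|z_m − c_m| ≤ 2r`, and `|M| ≤ B` wherever all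
`|z_m − c_m| ≤ 2r + 1`, then for `4|x_m − c_m| ≤ r` (`r ≥ 4`): `|M(x + eⱼ; k, l) − M(x; k, l)| ≤ C · B / r`. [folklore] -/
theorem closed_coclosed_gradient_le : ∃ C : ℝ, 0 < C ∧ ∀ (r : ℕ), 4 ≤ r →
    ∀ (M : Site 4 → Fin 4 → Fin 4 → ℝ) (c₀ : Site 4) (B : ℝ),
    (∀ z : Site 4, (∀ m, |z m - c₀ m| ≤ 2 * (r : ℤ)) → (∀ a b c, d₂ M z a b c = 0) ∧ (∀ a, div₂ M z a = 0)) →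
    (∀ z : Site 4, (∀ m, |z m - c₀ m| ≤ 2 * (r : ℤ) + 1) → ∀ k l, |M z k l| ≤ B) →
    ∀ x : Site 4, (∀ m, 4 * |x m - c₀ m| ≤ (r : ℤ)) → ∀ j k l : Fin 4, |M (x + e j) k l - M x k l| ≤ C * B / r := by
  obtain ⟨C, hC, h⟩ := harmonic_gradient_le_centre
  refine ⟨C, hC, fun r hr M c₀ B hcl hB x hx j k l => ?_⟩
  refine h r hr (fun z => M z k l) c₀ B (fun z hz => ?_) (fun z hz => hB z hz k l) x hx j
  refine latticeLaplacianZd_component_eq_zero M z (fun w hw a b c => (hcl w fun m => ?_).1 a b c)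
    (fun w hw a => (hcl w fun m => ?_).2 a) k l
  · have h1 := abs_le.1 (hw m); have h2 := abs_lt.1 (hz m); exact abs_le.2 ⟨by omega, by omega⟩
  · have h1 := abs_le.1 (hw m); have h2 := abs_lt.1 (hz m); exact abs_le.2 ⟨by omega, by omega⟩

end Forms

end Summit.QuantumFields.YangMills.Theorems.WeakCouplingRates.HarmonicInterior

end
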